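import Summits.Ventures.HSemireg.ObstructionLocusCrossingExtTwo

/-!
# Venture HSemireg — (S5) OBSTRUCTION LOCUS away from secant type, XXXVI: the INTRINSIC form of EXT-NOTE §6.B(c) at a crossing
# germ — `Ext²_R(I_M, I_M) ≃ₗ[R] Ext¹_R(I_S, I_S) ⊗_R Ext¹_R(I_{M′}, I_{M′}) = N_S ⊗_R N_{S′}` (two blocks, any K)

HONEST FRAMING.  Part of the Lean side of the computation cell `pub-hsemireg` (track «S4-PUSH» (ii), seat
s4-prove-2).  Plain commutative / homological algebra in `R = MvPolynomial (Fin n) K`, every `n`, EVERY commutative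
ring `K`.  Nothing here constructs a variety or a sheaf; nothing here says that HC / HC_CM / HC_AV holds; no Literature
fact is declared or used; no object is certified.

File XXXV's `extTwoEquivCrossing` presents `Ext²` of the ideal of a two-block model as the product of the cyclic modules
`R ⧸ ((x_{t.b}, x_{t.a}) + (x_{t′.b}, x_{t′.a}))` over pairs of branches.  This file rewrites the target intrinsically
(remark (i) of the source author's method read of CROSSING-EXT2-NOTE, deform-ring2 g273, 2026-08-24): the product of
cyclic modules is the tensor product of the two branch-function modules, and these are the two `Ext¹`'s.

* `piTensorPiQuotEquiv` — `(Π_t A ⧸ 𝔞_t) ⊗[A] (Π_{t′} A ⧸ J_{t′}) ≃ₗ[A] Π_{t′} Π_t A ⧸ (𝔞_t ⊔ J_{t′})` (finite index types);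
* **`extTwoEquivCrossingTensorBranch`** — `Ext²_R(I_M, I_M) ≃ₗ[R] N_S ⊗[R] N_{S′}`;
* **`extTwoEquivCrossingTensor`** — `Ext²_R(I_M, I_M) ≃ₗ[R] Ext¹_R(I_S, I_S) ⊗[R] Ext¹_R(I_{M′}, I_{M′})` (the `(1,1)` Künneth
  summand of §6.B(c) written over `R`, obtained without a Künneth formula).
References (dictionary only): EXT-NOTE.md §6.B(b)(c).
-/

open CategoryTheory CategoryTheory.Abelian MvPolynomial Finset TensorProduct
open scoped BigOperators TensorProduct

universe u

namespace Summit.Ventures.HSemireg.ObstructionLocus.BlockModel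

variable {K : Type u} [CommRing K] {n : ℕ}

/-! ## Tensor products of finite products of cyclic modules -/

section Tensor

variable {A : Type u} [CommRing A] {τ τ' : Type} [Fintype τ] [DecidableEq τ] [Fintype τ'] [DecidableEq τ']

/-- Swap of the two indices of a doubly indexed family. -/
def piComm₂ (X : τ → τ' → Type u) [∀ t t', AddCommGroup (X t t')] [∀ t t', Module A (X t t')] :
    ((t : τ) → (t' : τ') → X t t') ≃ₗ[A] ((t' : τ') → (t : τ) → X t t') where
  toFun f t' t := f t t'
  invFun g t t' := g t' t
  map_add' _ _ := rfl
  map_smul' _ _ := rfl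
  left_inv _ := rfl
  right_inv _ := rfl

/-- **`(Π_t A ⧸ 𝔞_t) ⊗[A] (Π_{t′} A ⧸ J_{t′}) ≃ₗ[A] Π_{t′} Π_t A ⧸ (𝔞_t ⊔ J_{t′})`.** -/
noncomputable def piTensorPiQuotEquiv (𝔞 : τ → Ideal A) (J : τ' → Ideal A) :
    (((t : τ) → A ⧸ 𝔞 t) ⊗[A] ((t' : τ') → A ⧸ J t')) ≃ₗ[A] ((t' : τ') → (t : τ) → A ⧸ (𝔞 t ⊔ J t')) :=
  (TensorProduct.piLeft A ((t' : τ') → A ⧸ J t') (fun t => A ⧸ 𝔞 t)).trans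
    ((LinearEquiv.piCongrRight fun t =>
      (TensorProduct.piRight A A (A ⧸ 𝔞 t) (fun t' => A ⧸ J t')).trans
        (LinearEquiv.piCongrRight fun t' =>
          (TensorProduct.tensorQuotEquivQuotSMul (A ⧸ 𝔞 t) (J t')).trans (quotQuotSmulTopEquiv (𝔞 t) (J t')))).trans
      (piComm₂ fun t t' => A ⧸ (𝔞 t ⊔ J t')))

end Tensor

/-! ## The intrinsic statements -/

section TwoBlocks

variable {ι : Type} [Fintype ι] [DecidableEq ι] (B : Blocks ι n) (i₀ : ι) [Unique {j // j ≠ i₀}]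
  {a₀ : Fin n} (ha₀ : a₀ ∈ B.S i₀)

include ha₀ in
/-- **`Ext²_R(I_M, I_M) ≃ₗ[R] N_S ⊗[R] N_{S′}`** — the tensor product of the branch functions of the two blocks. -/
noncomputable def extTwoEquivCrossingTensorBranch :
    Ext.{u} (ModuleCat.of (MvPolynomial (Fin n) K) ↥(arrIdeal K B))
        (ModuleCat.of (MvPolynomial (Fin n) K) ↥(arrIdeal K B)) 2
      ≃ₗ[MvPolynomial (Fin n) K]
        (BranchFunctions K (Blocks.single (B.S i₀) (B.nonempty i₀)) ⊗[MvPolynomial (Fin n) K]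
          BranchFunctions K (B.restrict (· ≠ i₀))) :=
  (extTwoEquivCrossing (K := K) B i₀ ha₀).trans
    (piTensorPiQuotEquiv (fun t : Branch (Blocks.single (B.S i₀) (B.nonempty i₀)) =>
        Ideal.span {(X t.1.2.2 : MvPolynomial (Fin n) K), X t.1.2.1})
      (fun t' : Branch (B.restrict (· ≠ i₀)) =>
        Ideal.span {(X t'.1.2.2 : MvPolynomial (Fin n) K), X t'.1.2.1})).symm

include ha₀ in
/-- **EXT-NOTE §6.B(c) at a crossing germ, INTRINSIC FORM: `Ext²_R(I_M, I_M) ≃ₗ[R] Ext¹_R(I_S, I_S) ⊗[R] Ext¹_R(I_{M′}, I_{M′})`**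
for every two-block model `M` (blocks `S = S_{i₀}` and `M′` = the other block), over any commutative `K` — the `(1,1)`
Künneth summand of §6.B(c) written over `R`, Künneth-free (`I_S` enters as the one-block model `Blocks.single S`). -/
noncomputable def extTwoEquivCrossingTensor :
    Ext.{u} (ModuleCat.of (MvPolynomial (Fin n) K) ↥(arrIdeal K B))
        (ModuleCat.of (MvPolynomial (Fin n) K) ↥(arrIdeal K B)) 2
      ≃ₗ[MvPolynomial (Fin n) K]
        (Ext.{u} (ModuleCat.of (MvPolynomial (Fin n) K) ↥(arrIdeal K (Blocks.single (B.S i₀) (B.nonempty i₀))))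
            (ModuleCat.of (MvPolynomial (Fin n) K) ↥(arrIdeal K (Blocks.single (B.S i₀) (B.nonempty i₀)))) 1
          ⊗[MvPolynomial (Fin n) K]
          Ext.{u} (ModuleCat.of (MvPolynomial (Fin n) K) ↥(arrIdeal K (B.restrict (· ≠ i₀))))
            (ModuleCat.of (MvPolynomial (Fin n) K) ↥(arrIdeal K (B.restrict (· ≠ i₀)))) 1) :=
  (extTwoEquivCrossingTensorBranch (K := K) B i₀ ha₀).trans
    (TensorProduct.congr (extOneEquivOfUnique K (Blocks.single (B.S i₀) (B.nonempty i₀))).symm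
      (extOneEquivOfUnique K (B.restrict (· ≠ i₀))).symm)

end TwoBlocks

end Summit.Ventures.HSemireg.ObstructionLocus.BlockModel
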